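import Mathlib.Analysis.SpecificLimits.Basic
import Literature.Barriers.NavierStokesRegularity.NavierStokesInequalitySingularSolutions
import Literature.Analysis.FluidPDE.NormalisedPressure
import HarnessLib

/-!
# Scheffer's switching construction: the two ingredients of `NavierStokesInequalitySingularSolution`

Barrier catalogue support file for `NavierStokesRegularity` (D-0021), decomposing the named fact
`Literature.Barriers.NavierStokesRegularity.NavierStokesInequalitySingularSolution` (Scheffer 1985 =
Ożański 2020, Thm. 1.5: a weak solution of the Navier–Stokes inequality (NSI) with a singular
point) along the architecture of its printed proof, in the simplified presentation of
W. S. Ożański, *On weak solutions to the Navier–Stokes inequality with internal singularities*,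
arXiv:1709.00602 (`Ozanski2017NSISingular`), §2 ("Sketch of the proof of Theorem 1") and §4
("The setting"); the original is V. Scheffer, Comm. Math. Phys. 101 (1985), Lemma 2.3 (the
switching lemma) and "Theorem 1.1 is a consequence of Lemma 6.4, Lemma 3.3 and Lemma 2.4" (p. 84).

## What is printed (Ożański 2017, §2, pp. 6–7)

Suppose there exist `T > 0`, a compact set `G ⊂ ℝ³` and a divergence-free vector field `u` with
`u ∈ C^∞(ℝ³ × [0,T]; ℝ³)` (:= infinitely differentiable on `ℝ³ × (-η, T + η)` for some `η > 0`),
`supp u(t) = G` for all `t ∈ [0,T]`, such that the Navier–Stokes inequality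
`∂ₜ|u|² ≤ -u·∇(|u|² + 2p) + 2ν u·Δu` ((2.1)) holds in `ℝ³ × [0,T]` for all `ν ∈ [0, ν₀]` for
some `ν₀ > 0`, where `p(t)` is the pressure function corresponding to `u(t)`
(`p = Σᵢⱼ ∂ᵢ∂ⱼΨ ∗ (uᵢuⱼ)`, `Ψ = (4π|x|)⁻¹`, his (1.1)/(3.2)); suppose further that for some
`τ ∈ (0,1)`, `z ∈ ℝ³` the affine map `Γ(x) = τx + z` maps `G` into itself and
`|u(Γ(x), T)| ≥ τ⁻¹ |u(x, 0)|` for all `x` ((2.2), "interior gain of magnitude"). Then, with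
`t_j = T Σ_{k<j} τ^{2k}`, `T₀ = lim t_j = T/(1 - τ²)`,
`u^{(j)}(x,t) = τ^{-j} u(Γ^{-j}(x), τ^{-2j}(t - t_j))` ((2.4)) and `𝔲(t) = u^{(j)}(t)` for
`t ∈ [t_j, t_{j+1})`, `𝔲(t) = 0` for `t ≥ T₀`, the field `𝔲` "satisfies the claims of Theorem 1":
it is a weak solution of the NSI for every `ν ∈ [0, ν₀]` (`sup ‖𝔲(t)‖₂ < ∞`,
`∫₀^∞ ‖∇𝔲‖₂² = Σ_j τ^j ∫₀^T ‖∇u‖₂² < ∞`, the local energy inequality by the per-interval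
inequality (1.5) and the magnitude drop `|u^{(j)}(x,t_j)| ≤ |u^{(j-1)}(x,t_j)|` ((2.6)) at every
switching time), divergence free, smooth in space with `supp 𝔲(t) ⊆ G`, and unbounded in every
neighbourhood of `(x₀, T₀)`, `{x₀} = ⋂_j Γ^j(G) = {z/(1 - τ)}`. This is the classical special
case of Scheffer's Lemma 2.3 (with `f₁ = |u(·,0)|`, `f₂ = |u(·,T)|`, `a = z`, singular point
`((1-τ)⁻¹a, (1-τ²)⁻¹T)`, and the hypothesis `f₁ ≠ 0`; see "Provenance and generality" below for
what the printed lemma assumes). The objects `T, ν₀, τ, z, G, u` are then constructed in §4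
(geometric arrangement (4.1)–(4.2), Lemma 8, the choice (4.13) of `ν₀`, Proposition 9) and §5:
"Note that `u` given by the proposition satisfies all the properties required in Section 2"
(p. 16).

## Provenance and generality of the switching lemma (audit gen 4, 2026-08-16)

Scheffer's own switching lemma is stated at the level of WEAK solutions and is strictly more
general than the classical format of Ożański's §2 rendered below. Scheffer 1985, p. 50: a 5-tuple
`(f₁, f₂, a, b, ν)` (`fᵢ ∈ C_c^∞(ℝ³)`, `fᵢ ≥ 0`, `a < b`, ONE viscosity `ν > 0`) is *admissible*
when there are `u, p` on `ℝ³ × [a,b]` with his (1.1)–(1.6) — `u(·,t) ∈ C^∞` supported in a fixed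
compact `K`, `div u = 0`, the pressure formula, `‖u(t)‖₂ ≤ M`, `|∇u|², |u|³, |u||p|` integrable —
and the local energy inequality on `ℝ³ × [a,b]` for every test function `φ ≥ 0` WITH ENVELOPE
BOUNDARY TERMS: the usual boundary terms `∫ ½|u(·,b)|²φ(·,b)` and `∫ ½|u(·,a)|²φ(·,a)` are
replaced by `∫ ½f₂²φ(·,b)` and `∫ ½f₁²φ(·,a)`, i.e. `f₁` is an upper envelope of the initial speed
and `f₂` a lower envelope of the final speed in the energy sense; such tuples chain when the
envelopes match (Lemma 2.2, stated for the axisymmetric "P-admissible" tuples). Lemma 2.3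
(p. 55): if `0 < τ < 1`, `T > 0`,
`ν > 0`, `a ∈ ℝ³`, `fᵢ ≥ 0`, `f₁ ≠ 0`, `(f₁, f₂, 0, T, ν)` is admissible and
`f₂(τx + a) ≥ τ⁻¹f₁(x)` for all `x` ((2.28)), then the recursively rescaled and switched field
(proof, p. 56: the same `t_j`, `T₀`, `u^{(j)}` as above, `u = 0` from `T₀` on) satisfies
(1.1)–(1.6) and the local energy inequality ((2.29)) on `ℝ³ × (0,∞)` and is not essentially
bounded on any neighbourhood of `((1-τ)⁻¹a, (1-τ²)⁻¹T)` ((2.30)). No joint smoothness in time, no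
constancy of `supp u(t)`, no interval of viscosities and no pointwise inequality is assumed. The
tree's `IsNSIBlock` is Ożański's classical format word for word (2017, §2, p. 6: `supp u(t) = G`
on `[0,T]`, the pointwise (2.1) for all `ν ∈ [0, ν₀]`), hence a SPECIAL CASE of Scheffer's data;
fact A below is the corresponding special case of Lemma 2.3 and fact B supplies such a block, so
the assembled barrier is exactly as printed either way. Two consequences for readers of the
audit files: (i) the format obstruction `IsNSIBlock.not_forall_apply_T_similarity_eq` of
`NavierStokesInequalityEdgeCondition` (no block reproduces its rescaled initial state, because
`supp u(T) = G ⊋ Γ(G)`) is an artefact of the constant-support format and is absent from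
Scheffer's admissible format, in which the support may recede during `[0,T]`; (ii) the exact edge
condition `e·∇p̃ ≤ 0` of that file uses the inequality at `ν = 0`, which the `IsNSIBlock` format
contains and Scheffer's (one `ν > 0`) does not — at a fixed `ν > 0` an edge where `|u|` vanishes
quadratically (`|u| = C d²`, slices `C^{1,1}`, admissible for `IsWeakNSISolution` though not for
the printed `C^∞` slices) tolerates a foreign pressure gradient `|e·∇p| ≤ 2νC` along the flow,
while a `C²` edge tolerates none (`ν ∂ₙ²|u| → 0`). Scheffer's own assessment of the time
singularity of his force, p. 50: "It should be emphasized that the `f` in the example is very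
singular … It is possible to smooth `f` a bit and make it `C^∞` on `ℝ³ × (0,1)`, but `f` would
still be a bizarre function" — asserted without proof and not reproduced since (Ożański 2019,
p. 10: the switching procedure "does not allow us to define the time derivative at the switching
time"); and his list of the construction's ideas (p. 50): (A) changing the direction of `u` at
discrete times — two NSI solutions on `(t₀,t₁)`, `(t₁,t₂)` combine iff `|u(x,t₁)|² ≥ |u'(x,t₁)|²`
a.e.; (B) changing the viscosity by scaling; (C) self-similarity — "If one could solve
`½w + ½x·∇w + w·∇w - νΔw + ∇q = g`, `∇·w = 0` for some `w(x), g(x)` with `w·g ≤ 0`, then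
`u = (1-t)^{-1/2}w((1-t)^{-1/2}x)` would be a singular solution of the Navier–Stokes inequality.
The construction used in this paper is different, but similar in spirit" (no such profile is in
print; a pure-swirl profile `w = f e_θ` is impossible for every `ν ≥ 0`: with `q = p̃[w]`
axisymmetric the condition reads `νLf ≥ ½∂_ρ(ρf)` on `{f > 0}`, `ρ = |x|`, and at a maximum point
of `ρf` one has `∂_ρ(ρf) = 0`, `Δ(ρf) = ρΔf ≤ 0`, so `Lf = Δf - f/r² < 0` — audit gen 4, not in
print); (D) nonlocal effects — "The direction of `u'` is chosen to oscillate in a way that makes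
the magnitude of `u''` grow, via the nonlocal effect of the pressure."

## Rendering

* `IsNSIBlock T ν₀ τ z G u` — the hypotheses of §2 verbatim (time first, `u : ℝ → ℝ³ → ℝ³`):
  joint smoothness on the open slab `(-η, T+η) × ℝ³` (`Fluid.IsSmoothSpaceTimeOn`), `div u(t) = 0`
  and `tsupport (u t) = G` for `t ∈ [0,T]`, the POINTWISE inequality (2.1) for all `ν ∈ [0,ν₀]`,
  `t ∈ [0,T]`, `x ∈ ℝ³`, written with the two-sided time derivative `Fluid.timeDeriv` of `|u|²`
  (the slab is open), `u·∇q = ⟪u, ∇q⟫` and `u·Δu = ⟪u, Δu⟫`; the pressure function of the slice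
  `u(t) ∈ C_c^∞` is the tree's accepted `Literature.NS.normalisedPressure (u t) = -Δ⁻¹∂ᵢ∂ⱼ(uᵢuⱼ)`
  (Tao's `p̃`, `FluidPDE/NormalisedPressure`), which for `C_c^∞` fields is Ożański's
  `Σ ∂ᵢ∂ⱼΨ ∗ (uᵢuⱼ)` (Gilbarg–Trudinger Lemma 4.2; the tree's
  `NS.normalisedPressure_eq_pressurePotential`). The nontriviality `u(·,0) ≢ 0` (Scheffer's
  `f₁ ≠ 0`, tacit in Ożański's sketch, where `G = R(Ū₁ ∪ Ū₂) ≠ ∅`) is an explicit field: without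
  it the "block" `u = 0`, `G = ∅` would satisfy every other hypothesis and have no singular point.
* `NSISwitching` (fact A) — the conclusion of §2 for the tree's `IsWeakNSISolution` (Ożański's
  Def. 2 = Ożański 2020 Def. 1.1, as vendored in `NavierStokesInequalitySingularSolutions`), with
  the pressure `t ↦ p̃[𝔲(t)]`, the explicit singular point `(T/(1-τ²), z/(1-τ))` in the essential
  sense `¬ Fluid.IsRegularPoint` (each `u^{(j)}` is continuous on its slab with
  `‖u^{(j)}(t_j)‖_∞ = τ^{-j}‖u(0)‖_∞ → ∞` and support in `Γ^j(G) → x₀`), and the two defining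
  features `𝔲 = u` on `[0,T)`, `𝔲 = 0` after `T₀`; the glued field is quantified existentially
  (its formula (2.4) is recorded above and in `switchTime`; the explicit construction is the
  business of the discharge).
* `NSIBlockExists` (fact B) — §4 Prop. 9 with the geometric arrangement of §5.
* `navierStokesInequalitySingularSolution_of_switching` — PROVED: A ∧ B ⇒ the barrier fact
  (`K = G`, `p = p̃[𝔲(·)]`, `(T₀, x₀)` as above; `T₀ > 0` since `0 < τ < 1`).

## References

* W. S. Ożański, arXiv:1709.00602 (2017), §2 (pp. 6–7), §4 (Lemma 8, (4.13), Prop. 9), §5.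
  [`Ozanski2017NSISingular`]
* V. Scheffer, Comm. Math. Phys. 101 (1985), 47–85: Thm. 1.1, p. 50 (ideas (A)–(D), the
  admissible 5-tuples), Lemma 2.2, Lemma 2.3 (p. 55), Lemmas 2.4, 3.3, 6.4. [`Scheffer1985`]
* W. S. Ożański, *The partial regularity theory of Caffarelli, Kohn, and Nirenberg and its
  sharpness*, Birkhäuser 2019, p. 10. [`Ozanski2019CKNBook`]
* W. S. Ożański, Comm. Math. Phys. 374 (2020), Def. 1.1, Thm. 1.5. [`Ozanski2019NSI`]
* D. Gilbarg, N. Trudinger, *Elliptic PDE of second order*, Lemma 4.2. [`GilbargTrudinger2001`]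
-/

noncomputable section

open MeasureTheory Set Function Filter Topology TopologicalSpace Laplacian
open scoped ENNReal InnerProductSpace RealInnerProductSpace ContDiff

namespace Literature.Barriers.NavierStokesRegularity

/-- Local notation for physical space `ℝ³ = EuclideanSpace ℝ (Fin 3)`. -/
local notation "ℝ³" => EuclideanSpace ℝ (Fin 3)

/-! ### The classical block (Ożański 2017, §2; the classical case of Scheffer 1985, Lemma 2.3) -/

/-- **A classical self-replicating block for the Navier–Stokes inequality** (the hypotheses of
Ożański 2017, §2, p. 6 — the classical special case of the admissible data of Scheffer 1985,
Lemma 2.3, see the module docstring, "Provenance and generality"): `T > 0`, `ν₀ > 0`,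
`τ ∈ (0,1)`, `z ∈ ℝ³`, a compact `G ⊆ ℝ³` and a field `u : ℝ × ℝ³ → ℝ³` (time first) such that
`u` is `C^∞` on the open slab `(-η, T + η) × ℝ³` for some `η > 0`; for `t ∈ [0,T]` the slice
`u(t)` is divergence free with `supp u(t) = G`; the **Navier–Stokes inequality**
`∂ₜ|u|² ≤ -u·∇(|u|² + 2p) + 2ν u·Δu` holds POINTWISE on `[0,T] × ℝ³` for every `ν ∈ [0, ν₀]`,
`p(t) = p̃[u(t)] = -Δ⁻¹∂ᵢ∂ⱼ(uᵢuⱼ)(t)` the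
pressure function of the slice (`Literature.Analysis.FluidPDE.normalisedPressure`); the similarity `Γ(x) = τx + z`
maps `G` into itself; the **gain of magnitude** `|u(Γ(x), T)| ≥ τ⁻¹|u(x, 0)|` holds for all `x`;
and `u(·, 0) ≢ 0` (Scheffer's `f₁ ≠ 0`).
[cite: Ozanski2017NSISingular, §2 (2.1)–(2.2)] [cite: Scheffer1985, Lemma 2.3] -/
structure IsNSIBlock (T ν₀ τ : ℝ) (z : ℝ³) (G : Set ℝ³) (u : ℝ → ℝ³ → ℝ³) : Prop where
  /-- The lifetime of the block is positive. -/
  T_pos : 0 < T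
  /-- The maximal viscosity is positive. -/
  ν₀_pos : 0 < ν₀
  /-- The similarity ratio is positive … -/
  τ_pos : 0 < τ
  /-- … and less than one. -/
  τ_lt_one : τ < 1
  /-- The common support `G` is compact. -/
  isCompact : IsCompact G
  /-- `u ∈ C^∞(ℝ³ × (-η, T + η))` for some `η > 0` (Ożański: "`u ∈ C^∞(ℝ³ × [0,T]; ℝ³)`"). -/
  smooth : ∃ η : ℝ, 0 < η ∧ Literature.Analysis.FluidPDE.IsSmoothSpaceTimeOn (Ioo (-η) (T + η)) u
  /-- `div u(t) = 0` for `t ∈ [0,T]`. -/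
  divFree : ∀ t ∈ Icc (0 : ℝ) T, Literature.Analysis.FluidPDE.VectorCalculus.IsDivFree (u t)
  /-- `supp u(t) = G` for `t ∈ [0,T]`. -/
  tsupport_eq : ∀ t ∈ Icc (0 : ℝ) T, tsupport (u t) = G
  /-- The pointwise Navier–Stokes inequality (2.1) on `[0,T] × ℝ³` for every `ν ∈ [0, ν₀]`:
  `∂ₜ|u|² ≤ -u·∇(|u|² + 2p) + 2ν u·Δu`, `p(t) = p̃[u(t)]`. -/
  nsi : ∀ ν ∈ Icc (0 : ℝ) ν₀, ∀ t ∈ Icc (0 : ℝ) T, ∀ x : ℝ³,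
    Literature.Analysis.FluidPDE.timeDeriv (fun s y => ‖u s y‖ ^ 2) t x ≤
      -⟪u t x, gradient (fun y => ‖u t y‖ ^ 2 + 2 * Literature.Analysis.FluidPDE.normalisedPressure (u t) y) x⟫ +
        2 * ν * ⟪u t x, Δ (u t) x⟫
  /-- `Γ(x) = τx + z` maps `G` into itself. -/
  mapsTo : MapsTo (fun x : ℝ³ => τ • x + z) G G
  /-- Interior gain of magnitude (2.2): `|u(Γ(x), T)| ≥ τ⁻¹ |u(x, 0)|`. -/
  gain : ∀ x : ℝ³, τ⁻¹ * ‖u 0 x‖ ≤ ‖u T (τ • x + z)‖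
  /-- The initial slice is not identically zero (Scheffer 1985, Lemma 2.3: `f₁ ≠ 0`). -/
  nontrivial : ∃ x : ℝ³, u 0 x ≠ 0

/-- The **switching times** `t_j = T Σ_{k<j} τ^{2k}` of the construction (`t₀ = 0`, `t₁ = T`,
`t_j ↑ T₀ = T/(1 - τ²)`); on `[t_j, t_{j+1})` the glued field is the rescaled copy
`u^{(j)}(x,t) = τ^{-j} u(Γ^{-j}(x), τ^{-2j}(t - t_j))`.
[cite: Ozanski2017NSISingular, §2 (2.3)–(2.4)] [cite: Scheffer1985, proof of Lemma 2.3 (p. 56)] -/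
def switchTime (T τ : ℝ) (j : ℕ) : ℝ :=
  T * ∑ k ∈ Finset.range j, τ ^ (2 * k)

/-- The **blow-up time** `T₀ = T/(1 - τ²) = lim_j t_j`. [cite: Ozanski2017NSISingular, §2] -/
def blowupTime (T τ : ℝ) : ℝ :=
  T / (1 - τ ^ 2)

/-- The **blow-up point** `x₀ = z/(1 - τ)`, the fixed point of `Γ(x) = τx + z`
(`{x₀} = ⋂_j Γ^j(G)`). [cite: Ozanski2017NSISingular, §2] -/
def blowupPoint (τ : ℝ) (z : ℝ³) : ℝ³ :=
  (1 - τ)⁻¹ • z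

/-- `t₀ = 0`. [folklore] -/
@[simp]
theorem switchTime_zero (T τ : ℝ) : switchTime T τ 0 = 0 := by
  simp [switchTime]

/-- `t₁ = T`. [folklore] -/
@[simp]
theorem switchTime_one (T τ : ℝ) : switchTime T τ 1 = T := by
  simp [switchTime]

/-- `t_{j+1} = t_j + T τ^{2j}`: the `j`-th piece lives for time `τ^{2j} T`. [folklore] -/
theorem switchTime_succ (T τ : ℝ) (j : ℕ) :
    switchTime T τ (j + 1) = switchTime T τ j + T * τ ^ (2 * j) := by
  simp [switchTime, Finset.sum_range_succ, mul_add]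

/-- Closed form `t_j = T (1 - τ^{2j})/(1 - τ²)` for `τ² ≠ 1`. [folklore] -/
theorem switchTime_eq (T : ℝ) {τ : ℝ} (hτ : τ ^ 2 ≠ 1) (j : ℕ) :
    switchTime T τ j = T * ((1 - τ ^ (2 * j)) / (1 - τ ^ 2)) := by
  have h : ∑ k ∈ Finset.range j, τ ^ (2 * k) = ∑ k ∈ Finset.range j, (τ ^ 2) ^ k :=
    Finset.sum_congr rfl fun k _ => pow_mul τ 2 k
  rw [switchTime, h, geom_sum_eq hτ, pow_mul]
  have h1 : (1 : ℝ) - τ ^ 2 ≠ 0 := sub_ne_zero.2 (Ne.symm hτ)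
  have h2 : τ ^ 2 - 1 ≠ 0 := sub_ne_zero.2 hτ
  field_simp
  ring

/-- The switching times increase strictly when `T > 0`, `τ > 0`. [folklore] -/
theorem strictMono_switchTime {T τ : ℝ} (hT : 0 < T) (hτ : 0 < τ) :
    StrictMono (switchTime T τ) := by
  refine strictMono_nat_of_lt_succ fun j => ?_
  rw [switchTime_succ]
  have : 0 < τ ^ (2 * j) := pow_pos hτ _
  nlinarith

/-- `t_j < T₀` for `T > 0`, `0 < τ < 1`. [cite: Ozanski2017NSISingular, §2] -/
theorem switchTime_lt_blowupTime {T τ : ℝ} (hT : 0 < T) (hτ₀ : 0 < τ) (hτ₁ : τ < 1) (j : ℕ) :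
    switchTime T τ j < blowupTime T τ := by
  have hτ2 : τ ^ 2 < 1 := pow_lt_one₀ hτ₀.le hτ₁ two_ne_zero
  have hne : τ ^ 2 ≠ 1 := hτ2.ne
  rw [switchTime_eq T hne, blowupTime, mul_div_assoc']
  have hpos : 0 < 1 - τ ^ 2 := sub_pos.2 hτ2
  rw [div_lt_div_iff_of_pos_right hpos]
  have : 0 < τ ^ (2 * j) := pow_pos hτ₀ _
  nlinarith

/-- `t_j → T₀ = T/(1 - τ²)` (geometric series). [cite: Ozanski2017NSISingular, §2] -/
theorem tendsto_switchTime {T τ : ℝ} (hτ₀ : 0 ≤ τ) (hτ₁ : τ < 1) :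
    Tendsto (switchTime T τ) atTop (𝓝 (blowupTime T τ)) := by
  have hτ2 : τ ^ 2 < 1 := pow_lt_one₀ hτ₀ hτ₁ two_ne_zero
  have h := (hasSum_geometric_of_lt_one (sq_nonneg τ) hτ2).tendsto_sum_nat
  have h' : Tendsto (fun j => T * ∑ k ∈ Finset.range j, (τ ^ 2) ^ k) atTop
      (𝓝 (T * (1 - τ ^ 2)⁻¹)) := h.const_mul T
  have heq : (fun j => T * ∑ k ∈ Finset.range j, (τ ^ 2) ^ k) = switchTime T τ := by
    funext j
    simp [switchTime, pow_mul]
  rw [heq, ← div_eq_mul_inv] at h'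
  exact h'

/-- `x₀ = z/(1-τ)` is the fixed point of `Γ(x) = τx + z` (`τ ≠ 1`). [folklore] -/
theorem smul_blowupPoint_add {τ : ℝ} (hτ : τ ≠ 1) (z : ℝ³) :
    τ • blowupPoint τ z + z = blowupPoint τ z := by
  have h1 : (1 : ℝ) - τ ≠ 0 := sub_ne_zero.2 (Ne.symm hτ)
  rw [blowupPoint, smul_smul]
  have : τ * (1 - τ)⁻¹ = (1 - τ)⁻¹ - 1 := by field_simp; ring
  rw [this, sub_smul, one_smul, sub_add_cancel]

namespace IsNSIBlock

variable {T ν₀ τ : ℝ} {z : ℝ³} {G : Set ℝ³} {u : ℝ → ℝ³ → ℝ³}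

/-- `0 < 1 - τ²`. [folklore] -/
theorem one_sub_sq_pos (h : IsNSIBlock T ν₀ τ z G u) : 0 < 1 - τ ^ 2 :=
  sub_pos.2 (pow_lt_one₀ h.τ_pos.le h.τ_lt_one two_ne_zero)

/-- The blow-up time `T₀ = T/(1-τ²)` is positive. [cite: Ozanski2017NSISingular, §2] -/
theorem blowupTime_pos (h : IsNSIBlock T ν₀ τ z G u) : 0 < blowupTime T τ :=
  div_pos h.T_pos h.one_sub_sq_pos

/-- `T < T₀` (the first piece ends before the blow-up time). [folklore] -/
theorem lt_blowupTime (h : IsNSIBlock T ν₀ τ z G u) : T < blowupTime T τ := by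
  simpa using switchTime_lt_blowupTime h.T_pos h.τ_pos h.τ_lt_one 1

/-- The slices `u(t)`, `t ∈ [0,T]`, are `C^∞`. [folklore] -/
theorem contDiff_slice (h : IsNSIBlock T ν₀ τ z G u) {t : ℝ} (ht : t ∈ Icc (0 : ℝ) T) :
    ContDiff ℝ ∞ (u t) := by
  obtain ⟨η, hη, hs⟩ := h.smooth
  exact hs.contDiff_slice ⟨by linarith [ht.1], by linarith [ht.2]⟩

/-- The slices `u(t)`, `t ∈ [0,T]`, have compact support (`= G`). [folklore] -/
theorem hasCompactSupport_slice (h : IsNSIBlock T ν₀ τ z G u) {t : ℝ} (ht : t ∈ Icc (0 : ℝ) T) :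
    HasCompactSupport (u t) := by
  rw [HasCompactSupport, h.tsupport_eq t ht]
  exact h.isCompact

/-- The common support is nonempty (from `u(·,0) ≢ 0` and `supp u(0) = G`). [folklore] -/
theorem nonempty (h : IsNSIBlock T ν₀ τ z G u) : G.Nonempty := by
  obtain ⟨x, hx⟩ := h.nontrivial
  refine ⟨x, ?_⟩
  rw [← h.tsupport_eq 0 ⟨le_rfl, h.T_pos.le⟩]
  exact subset_tsupport _ (Function.mem_support.2 hx)

/-- All iterates `Γ^j` map `G` into itself, so `supp u^{(j)}(t) ⊆ Γ^j(G) ⊆ G`.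
[cite: Ozanski2017NSISingular, §2 (2.5)] -/
theorem mapsTo_iterate (h : IsNSIBlock T ν₀ τ z G u) (j : ℕ) :
    MapsTo (fun x : ℝ³ => τ • x + z)^[j] G G :=
  h.mapsTo.iterate j

/-- The blow-up point is fixed by `Γ`, hence lies in every `Γ^j(G)` as soon as it lies in `G`.
[folklore] -/
theorem iterate_blowupPoint (h : IsNSIBlock T ν₀ τ z G u) (j : ℕ) :
    (fun x : ℝ³ => τ • x + z)^[j] (blowupPoint τ z) = blowupPoint τ z :=
  Function.iterate_fixed (smul_blowupPoint_add h.τ_lt_one.ne z) j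

end IsNSIBlock

/-! ### The two named facts and the assembled barrier -/

/-- **Fact A — the switching principle** (Ożański 2017, §2, pp. 6–7; the classical case of
Scheffer 1985, Lemma 2.3, whose printed hypotheses are at the level of weak solutions — module
docstring, "Provenance and generality"). For every classical block `(T, ν₀, τ, z, G, u)`
(`IsNSIBlock`) there is a field `𝔲 : [0,∞) × ℝ³ → ℝ³` — in print the recursively rescaled and
glued field
`𝔲(t) = u^{(j)}(t) = τ^{-j}u(Γ^{-j}·, τ^{-2j}(t - t_j))` on `[t_j, t_{j+1})`, `𝔲(t) = 0` for
`t ≥ T₀ = T/(1-τ²)` — which agrees with `u` on `[0,T)`, vanishes from `T₀` on, is a weak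
solution of the Navier–Stokes inequality on `ℝ³ × (0,∞)` (tree rendering `IsWeakNSISolution`,
with its pressure function `p(t) = p̃[𝔲(t)]`) for EVERY `ν ∈ [0, ν₀]`, has `C^∞` slices
supported in `G` for all `t ≥ 0`, and is singular at `(T₀, x₀)`, `x₀ = z/(1-τ)`: not
essentially bounded on any centred parabolic cylinder about it ("unbounded in every
neighbourhood of `(x₀,T₀)`"; Scheffer: "not essentially bounded on any neighborhood"). The glued
field is quantified existentially here. [cite: Ozanski2017NSISingular, §2 (pp. 6–7)]
[cite: Scheffer1985, Lemma 2.3] -/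
def NSISwitching : Prop :=
  ∀ (T ν₀ τ : ℝ) (z : ℝ³) (G : Set ℝ³) (u : ℝ → ℝ³ → ℝ³), IsNSIBlock T ν₀ τ z G u →
    ∃ 𝔲 : ℝ → ℝ³ → ℝ³,
      (∀ t ∈ Ico (0 : ℝ) T, 𝔲 t = u t) ∧
      (∀ t : ℝ, blowupTime T τ ≤ t → 𝔲 t = 0) ∧
      (∀ ν ∈ Icc (0 : ℝ) ν₀, IsWeakNSISolution ν 𝔲 fun t => Literature.Analysis.FluidPDE.normalisedPressure (𝔲 t)) ∧
      (∀ t : ℝ, 0 ≤ t → ContDiff ℝ ∞ (𝔲 t) ∧ tsupport (𝔲 t) ⊆ G) ∧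
      ¬ Literature.Analysis.FluidPDE.IsRegularPoint 𝔲 (blowupTime T τ, blowupPoint τ z)

/-- **Fact B — existence of a classical block** (Ożański 2017, §4: the geometric arrangement
(4.1)–(4.2) with its structures `(v₁,f₁,φ₁)`, `(v₂,f₂,φ₂)` on `U₁, U₂ ⋐ P`, `G = R(Ū₁ ∪ Ū₂)`,
Lemma 8, the choice (4.13) of `ν₀ ∈ (0,1)`, and Proposition 9: an axisymmetric
`u ∈ C^∞(ℝ³ × (-η, T+η); ℝ³)` with `supp u(t) = G`, `div u(t) = 0`, satisfying the pointwise
NSI for all `ν ∈ [0,ν₀]`, and the gain (2.2) by Prop. 9 (ii) and (3.14); the arrangement itself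
is constructed in §5 — "Note that `u` given by the proposition satisfies all the properties
required in Section 2", p. 16). Scheffer 1985: Lemmas 3.3, 6.4 and 2.4 (p. 84).
There exist `T, ν₀, τ, z, G, u` forming an `IsNSIBlock`.
[cite: Ozanski2017NSISingular, §4 Prop. 9 and §5] [cite: Scheffer1985, Lemmas 2.4, 3.3, 6.4] -/
def NSIBlockExists : Prop :=
  ∃ (T ν₀ τ : ℝ) (z : ℝ³) (G : Set ℝ³) (u : ℝ → ℝ³ → ℝ³), IsNSIBlock T ν₀ τ z G u

/-- **Assembly (proved): Scheffer's theorem from the switching principle and the block.** Facts A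
and B imply the barrier fact `NavierStokesInequalitySingularSolution` (Scheffer 1985, Thm. 1.1 in
the form of Ożański 2020, Thm. 1.5), with `K = G`, pressure `p(t) = p̃[𝔲(t)]` and singular point
`(T₀, x₀) = (T/(1-τ²), z/(1-τ))`, `T₀ > 0`. This is the last paragraph of Ożański 2017, §2
("Therefore we have established the proof of Theorem 1 given the existence of `T, G, u, ν₀, τ`
and `z` with the properties listed above"). [cite: Ozanski2017NSISingular, §2 (p. 6)] -/
theorem navierStokesInequalitySingularSolution_of_switching (hA : NSISwitching)
    (hB : NSIBlockExists) : NavierStokesInequalitySingularSolution := by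
  obtain ⟨T, ν₀, τ, z, G, u, hb⟩ := hB
  obtain ⟨𝔲, -, -, hsol, hslice, hsing⟩ := hA T ν₀ τ z G u hb
  exact ⟨ν₀, hb.ν₀_pos, G, 𝔲, fun t => Literature.Analysis.FluidPDE.normalisedPressure (𝔲 t), hb.isCompact, hsol, hslice,
    blowupTime T τ, blowupPoint τ z, hb.blowupTime_pos, hsing⟩

end Literature.Barriers.NavierStokesRegularity
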